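import Literature.NumberTheory.GaloisRepresentations.IdeleLocalInvariantsRestriction
import Literature.Algebra.Homology.ShapiroExplicit
import HarnessLib

/-!
# Restriction of the idèle local invariants at the INFINITE places along a tower `F ⊆ K ⊆ E`:
# `inv_{v'}(Res_{Gal(E/K)} c) = [K_{v'} : F_v] · inv_v(c)` (Tate, C–F VII §9.7 (15), archimedean places)

Topic `NumberTheory/GaloisRepresentations`; namespaces `Literature.NumberTheory.GaloisRepresentations.ArchHerbrand` (the
archimedean semi-local module `∏_{w∣v} E_wˣ = infUnits E v` under restriction) and `….IdeleCohomology`.  Sequel to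
`IdeleLocalInvariantsRestriction.lean` (finite places: `ideleRes F K E n`, `localInv_ideleRes`); uses
`SemiLocalArchimedeanShapiro.lean` (`groupCohomologyArchUnitsRepIso w₀ n : Hⁿ(G, ∏_{w∣v} E_wˣ) ≅ Hⁿ(Stab(w₀), E_{w₀}ˣ)`),
`IdeleLocalInvariantsRange.lean` / `…Canonical.lean` (`archInvAt`, `localInvInfAt`, `natCard_stabilizer_nsmul_localInvInfAt`,
`addMonoidHom_eq_of_injective_of_natCard`) and the engine's `ShapiroExplicit` (`coindIso_hom_eq`: Mathlib's Shapiro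
isomorphism is restriction followed by evaluation at `1`).  Definitions with bodies (block / restriction morphisms) and
theorems; NO named fact, no `sorry`, no instance, no notation; number fields in `Type`.

Mathematics (Tate, C–F VII §9.7 (15) `inv_w(res^G_H α) = n_{w/v} inv_v(α)`, `n_{w/v} = [L_w : K_v]`, at an archimedean
`v`).  For `E/F` Galois with group `G`, `H = Gal(E/K)`, an infinite place `w₀` of `E` above `v'` of `K` above `v` of `F`:
the block of `J_E` at `v` restricted to `H` projects onto the block at `v'` (§1–§2); under the Shapiro isomorphisms at
`w₀` for `E/F` and for `E/K` this projection becomes the restriction `Hⁿ(Stab_G(w₀), E_{w₀}ˣ) → Hⁿ(Stab_H(w₀), E_{w₀}ˣ)`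
along `Stab_H(w₀) ↪ Stab_G(w₀)` (§3–§4).  The decomposition groups have order `n_v = [E_{w₀}:F_v]`,
`n_{v'} = [E_{w₀}:K_{v'}] ∈ {1, 2}`, and `[K_{v'}:F_v] = n_v / n_{v'}`; if `n_{v'} = 1` the target group is zero and
`(n_v/n_{v'}) · inv_v(c) = n_v · inv_v(c) = 0`; if `n_{v'} = 2` then `n_v = 2`, the restriction is an isomorphism, and two
injective homomorphisms from a group of order `2` into `ℚ/ℤ` coincide (§5).

## What is formalised (`F K E : Type` number fields, `IsScalarTower F K E`, `E/F` Galois where marked)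

* §1 `ArchHerbrand.archTowerBlockHom v v' : infUnits E v →* infUnits E v'` (cut off to the places above `v'`),
  `archTowerBlock v v' : Res_{Gal(E/K)} (∏_{w∣v} E_wˣ) ⟶ ∏_{w∣v'} E_wˣ` in `Rep ℤ Gal(E/K)`, components.
* §2 `IdeleCohomology.res_infPlaceProj_comp_archTowerBlock` (restriction commutes with the infinite-place blocks),
  `map_infPlaceProj_ideleRes`.
* §3 `ArchHerbrand.archProjRepHom w₀` (`π_{w₀}` as a `Stab(w₀)`-morphism), **`groupCohomologyArchUnitsRepIso_hom_eq`**: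
  the archimedean Shapiro isomorphism IS `Hⁿ(Stab(w₀) ↪ G, π_{w₀})` (restriction + projection).
* §4 `stabilizerTowerHom w₀ : Stab_{Gal(E/K)}(w₀) →* Stab_{Gal(E/F)}(w₀)`, `archLocalResHom w₀`, `archLocalRes w₀ n`,
  **`groupCohomologyArchUnitsRepIso_hom_map_archTowerBlock`** (Shapiro under restriction),
  `archLocalRes_injective_of_natCard_eq` (an isomorphism when the two decomposition groups have the same order).
* §5 **`IdeleCohomology.localInvInfAt_ideleRes`**:
  `localInvInfAt w₀ (Res c) = (#Stab_G(w₀) / #Stab_H(w₀)) • localInvInfAt w₀ c`, and `localInvInf_ideleRes`.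

Not here: the identification `#Stab_G(w₀) / #Stab_H(w₀) = [K_{v'} : F_v]` with Mathlib's `InfinitePlace.IsUnramified`, and
the sum over all places (Tate §11.2 (7)) — next file.

## References
* J. W. S. Cassels, A. Fröhlich (eds.), *Algebraic Number Theory* (1967), Ch. VII (J. Tate) §9.7 formula (15), §7.2–§7.3.
  [CasselsFrohlichANT1967]
* K. S. Brown, *Cohomology of Groups*, GTM 87 (1982), III (5.8), (6.2). [Brown1982CohomologyGroups]
-/

noncomputable section

open NumberField NumberField.InfinitePlace CategoryTheory groupCohomology
open Literature.NumberTheory.Automorphic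
open scoped Classical

namespace Literature.NumberTheory.GaloisRepresentations

/-! ## §1. The archimedean block of `Res_{Gal(E/K)} J_E` at `v' ∣ v` -/

namespace ArchHerbrand

open Literature.Algebra.Homology

section Tower

variable {F K E : Type} [Field F] [Field K] [Field E] [NumberField F] [NumberField K] [NumberField E]
  [Algebra F K] [Algebra K E] [Algebra F E] [IsScalarTower F K E]

omit [NumberField F] [NumberField K] [NumberField E] in
/-- A place of `E` above the place `v'` of `K` is above the place of `F` below `v'`
(`w ∩ F = (w ∩ K) ∩ F`). [cite: CasselsFrohlichANT1967, Ch. II §11] -/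
theorem isOver_of_isOver_tower {v : InfinitePlace F} {v' : InfinitePlace K} (hv' : IsOver K v v')
    {w : InfinitePlace E} (hw : IsOver E v' w) : IsOver E v w := by
  change w.comap (algebraMap F E) = v
  rw [← InfinitePlace.comap_comap_tower F K E w]
  change w.comap (algebraMap K E) = v' at hw
  change v'.comap (algebraMap F K) = v at hv'
  rw [hw, hv']

variable (E) in
/-- **`∏_{w∣v} E_wˣ →* ∏_{w∣v'} E_wˣ`**: cut an archimedean idèle supported above `v` off to the places above the place
`v'` of `K` (`cutoff E v'` restricted to `infUnits E v`). [cite: CasselsFrohlichANT1967, Ch. VII §7.3] -/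
def archTowerBlockHom (v : InfinitePlace F) (v' : InfinitePlace K) : infUnits E v →* infUnits E v' :=
  (cutoff E v').comp (infUnits E v).subtype

omit [NumberField F] [NumberField K] [NumberField E] [Algebra F K] [IsScalarTower F K E] in
/-- Components of `archTowerBlockHom v v' u`: `u_w` above `v'`, `1` elsewhere. [cite: CasselsFrohlichANT1967, Ch. VII §7.3] -/
theorem coe_archTowerBlockHom_apply (v : InfinitePlace F) (v' : InfinitePlace K) (u : infUnits E v) (w : InfinitePlace E) :
    (((archTowerBlockHom E v v' u : infUnits E v') : (InfiniteAdeleRing E)ˣ) : InfiniteAdeleRing E) w =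
      if IsOver E v' w then ((u : (InfiniteAdeleRing E)ˣ) : InfiniteAdeleRing E) w else 1 :=
  coe_cutoff_apply v' (u : (InfiniteAdeleRing E)ˣ) w

variable (E) in
/-- **The block at `v' ∣ v`: `Res_{Gal(E/K)} (∏_{w∣v} E_wˣ) ⟶ ∏_{w∣v'} E_wˣ` in `Rep ℤ Gal(E/K)`** (the cut-off is
`Gal(E/K)`-equivariant, `coe_cutoff_smul`; an element of `Gal(E/K)` acts on archimedean idèles as its restriction of
scalars to `F`). [cite: CasselsFrohlichANT1967, Ch. VII §7.3] -/
def archTowerBlock (v : InfinitePlace F) (v' : InfinitePlace K) :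
    Rep.res (AlgEquiv.restrictScalarsHom F : (E ≃ₐ[K] E) →* (E ≃ₐ[F] E)) (archUnitsRep (E := E) v) ⟶
      archUnitsRep (E := E) v' :=
  Rep.ofHom (LinearMap.intertwiningMap_of_isIntertwiningMap _ _
    (MonoidHom.toAdditive (archTowerBlockHom E v v')).toIntLinearMap fun σ x => by
      apply (Additive.toMul (α := infUnits E v')).injective
      apply Subtype.ext
      exact coe_cutoff_smul v' σ (((Additive.toMul x : infUnits E v)) : (InfiniteAdeleRing E)ˣ))

omit [NumberField F] [NumberField K] [NumberField E] in
/-- Unfolding `archTowerBlock`. [cite: CasselsFrohlichANT1967, Ch. VII §7.3] -/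
theorem toMul_archTowerBlock_apply (v : InfinitePlace F) (v' : InfinitePlace K) (x : Additive (infUnits E v)) :
    Additive.toMul ((archTowerBlock E v v').hom x) = archTowerBlockHom E v v' (Additive.toMul x) := rfl

omit [NumberField F] [NumberField K] [NumberField E] in
/-- **`π_w ∘ (block at v') = π_w`** for `w ∣ v'`: the block does not change the components above `v'`.
[cite: CasselsFrohlichANT1967, Ch. VII §7.3] -/
theorem archProj_archTowerBlock (v : InfinitePlace F) (v' : InfinitePlace K) {w : InfinitePlace E} (hw : IsOver E v' w)
    (x : Additive (infUnits E v)) :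
    archProj (E := E) v' w ((archTowerBlock E v v').hom x) = archProj (E := E) v w x := by
  apply (Additive.toMul (α := (w.Completion)ˣ)).injective
  refine Units.ext ?_
  rw [coe_toMul_archProj, coe_toMul_archProj]
  change (((archTowerBlockHom E v v' (Additive.toMul x) : infUnits E v') : (InfiniteAdeleRing E)ˣ) :
      InfiniteAdeleRing E) w = _
  rw [coe_archTowerBlockHom_apply, if_pos hw]

end Tower

end ArchHerbrand

/-! ## §2. Restriction commutes with the infinite-place blocks -/

namespace IdeleCohomology

open Literature.Algebra.Homology ArchHerbrand

section Tower

variable {F K E : Type} [Field F] [Field K] [Field E] [NumberField F] [NumberField K] [NumberField E]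
  [Algebra F K] [Algebra K E] [Algebra F E] [IsScalarTower F K E]

omit [NumberField F] [NumberField K] in
/-- **Restriction commutes with the infinite-place projections**: on `Res_{Gal(E/K)} J_E`, projecting to the block
`∏_{w∣v} E_wˣ` and cutting off to the places above `v' ∣ v` is the block projection of the idèle module of `E/K` at `v'`.
[cite: CasselsFrohlichANT1967, Ch. VII §7.3] -/
theorem res_infPlaceProj_comp_archTowerBlock {v : InfinitePlace F} {v' : InfinitePlace K} (hv' : IsOver K v v') :
    (Rep.resFunctor (AlgEquiv.restrictScalarsHom F : (E ≃ₐ[K] E) →* (E ≃ₐ[F] E))).map (infPlaceProj (E := E) v) ≫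
        archTowerBlock E v v' =
      ideleResHom F K E ≫ infPlaceProj (E := E) v' := by
  refine Rep.hom_ext (Representation.IntertwiningMap.ext (LinearMap.ext fun x => ?_))
  apply (Additive.toMul (α := infUnits E v')).injective
  change archTowerBlockHom E v v' (cutoff E v (IdeleHerbrand.infHom E (Additive.toMul x))) =
    cutoff E v' (IdeleHerbrand.infHom E (Additive.toMul x))
  refine Subtype.ext (Units.ext (funext fun w => ?_))
  rw [coe_archTowerBlockHom_apply, coe_cutoff_apply v']
  by_cases hw : IsOver E v' w
  · rw [if_pos hw, if_pos hw, coe_cutoff_apply_of_isOver _ (isOver_of_isOver_tower hv' hw)]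
  · rw [if_neg hw, if_neg hw]

omit [NumberField F] [NumberField K] in
/-- **`Hⁿ(infPlaceProj v')(Res c) = Hⁿ(Res)(Hⁿ(infPlaceProj v)(c))`** for `v' ∣ v` infinite.
[cite: CasselsFrohlichANT1967, Ch. VII §9.7] -/
theorem map_infPlaceProj_ideleRes {v : InfinitePlace F} {v' : InfinitePlace K} (hv' : IsOver K v v') (n : ℕ)
    (c : groupCohomology (IdeleClassGroup.ideleRep F E) n) :
    groupCohomology.map (MonoidHom.id (E ≃ₐ[K] E)) (infPlaceProj (E := E) v') n (ideleRes F K E n c) =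
      groupCohomology.map (AlgEquiv.restrictScalarsHom F) (archTowerBlock E v v') n
        (groupCohomology.map (MonoidHom.id (E ≃ₐ[F] E)) (infPlaceProj (E := E) v) n c) := by
  have key : ideleRes F K E n ≫ groupCohomology.map (MonoidHom.id (E ≃ₐ[K] E)) (infPlaceProj (E := E) v') n =
      groupCohomology.map (MonoidHom.id (E ≃ₐ[F] E)) (infPlaceProj (E := E) v) n ≫
        groupCohomology.map (AlgEquiv.restrictScalarsHom F) (archTowerBlock E v v') n := by
    rw [ideleRes, ← groupCohomology.map_comp, ← groupCohomology.map_comp]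
    refine map_congr' ?_ _ _ (fun x => ?_) n
    · ext σ; rfl
    · exact (congrArg (fun φ => φ.hom x) (res_infPlaceProj_comp_archTowerBlock (E := E) hv')).symm
  exact congrArg (fun φ => φ.hom c) key

end Tower

end IdeleCohomology

/-! ## §3. The archimedean Shapiro isomorphism is restriction followed by the `w₀`-projection -/

namespace ArchHerbrand

open Literature.Algebra.Homology

section Shapiro

variable {F E : Type} [Field F] [Field E] [Algebra F E]

/-- **`π_{w₀} : (∏_{w∣v} E_wˣ)|_{Stab(w₀)} ⟶ E_{w₀}ˣ` as a morphism of `Stab(w₀)`-modules** (`(g u)_{w₀} = g_{w₀}(u_{w₀})` for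
`g ∈ Stab(w₀)`; `v = w₀|_F`). [cite: Brown1982CohomologyGroups, III §5 Prop. (5.8)] -/
def archProjRepHom (w₀ : InfinitePlace E) :
    Rep.res (MulAction.stabilizer (E ≃ₐ[F] E) w₀).subtype (archUnitsRep (E := E) (w₀.comap (algebraMap F E))) ⟶
      archLocalUnitsRep (F := F) w₀ :=
  Rep.ofHom (LinearMap.intertwiningMap_of_isIntertwiningMap _ _ (archProj (E := E) (w₀.comap (algebraMap F E)) w₀)
    fun g x => by
      apply (Additive.toMul (α := (w₀.Completion)ˣ)).injective
      refine Units.ext ?_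
      change ((Additive.toMul (archProj (E := E) (w₀.comap (algebraMap F E)) w₀
          (archUnitsRepr (E := E) (w₀.comap (algebraMap F E)) (g : E ≃ₐ[F] E) x)) : (w₀.Completion)ˣ) : w₀.Completion) =
        ((Additive.toMul (archLocalUnitsRepr (F := F) w₀ g (archProj (E := E) (w₀.comap (algebraMap F E)) w₀ x)) :
          (w₀.Completion)ˣ) : w₀.Completion)
      rw [coe_toMul_archProj, coe_toMul_archLocalUnitsRepr, coe_toMul_archProj, Herbrand.coe_toMul_stableRepr,
        MulDistribMulAction.toMulAut_apply, MulDistribMulAction.toMulEquiv_apply, smul_units_apply]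
      exact galInfiniteCompletionMap_apply_congr_place (F := F) (E := E)
        (inv_smul_eq_iff.mpr (MulAction.mem_stabilizer_iff.mp g.2).symm) _ _ _)

/-- Unfolding: `archProjRepHom w₀` is `archProj v w₀` on elements. [cite: Brown1982CohomologyGroups, III §5 Prop. (5.8)] -/
theorem archProjRepHom_hom_apply (w₀ : InfinitePlace E) (x : Additive (infUnits E (w₀.comap (algebraMap F E)))) :
    (archProjRepHom (F := F) w₀).hom x = archProj (E := E) (w₀.comap (algebraMap F E)) w₀ x := rfl

/-- **The archimedean Shapiro isomorphism is restriction to `Stab(w₀)` followed by the `w₀`-projection**: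
`Sh_{w₀} = Hⁿ(Stab(w₀) ↪ G, π_{w₀})` (Mathlib's `coindIso` is `Hⁿ(S ↪ G, ev₁)` — the engine's `coindIso_hom_eq` — and
`ev₁ ∘ (u ↦ (g ↦ (g u)_{w₀})) = π_{w₀}`; the final `mapIso` along `Stab(basePt) = Stab(w₀)` is the identity on elements).
[cite: CasselsFrohlichANT1967, Ch. VII §7.2][cite: Brown1982CohomologyGroups, III (6.2)] -/
theorem groupCohomologyArchUnitsRepIso_hom_eq [IsGalois F E] [Fintype (E ≃ₐ[F] E)] (w₀ : InfinitePlace E) (n : ℕ) :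
    (groupCohomologyArchUnitsRepIso (F := F) w₀ n).hom =
      groupCohomology.map (MulAction.stabilizer (E ≃ₐ[F] E) w₀).subtype (archProjRepHom (F := F) w₀) n := by
  rw [groupCohomologyArchUnitsRepIso, Iso.trans_hom, Iso.trans_hom, Functor.mapIso_hom, coindIso_hom_eq,
    groupCohomology.mapIso_hom]
  -- merge the last two factors, then the first (unification, not rewriting: the objects are `(functor ℤ G n).obj _`)
  refine (congrArg (fun t => (groupCohomology.functor ℤ (E ≃ₐ[F] E) n).map (archUnitsRepIsoCoind (F := F) w₀).hom ≫ t)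
    (groupCohomology.map_comp (MulAction.stabilizer (E ≃ₐ[F] E) (basePt (F := F) w₀)).subtype
      ((MulEquiv.subgroupCongr (stabilizer_basePt (F := F) w₀)).symm :
        MulAction.stabilizer (E ≃ₐ[F] E) w₀ →* MulAction.stabilizer (E ≃ₐ[F] E) (basePt (F := F) w₀)) _ _ n)).symm.trans ?_
  refine (groupCohomology.map_comp (A := archUnitsRep (E := E) (w₀.comap (algebraMap F E))) (MonoidHom.id (E ≃ₐ[F] E))
    _ (archUnitsRepIsoCoind (F := F) w₀).hom _ n).symm.trans ?_
  refine map_congr' ?_ _ _ (fun x => ?_) n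
  · ext g; rfl
  · change ((archUnitsRepIsoCoind (F := F) w₀).hom.hom x).1 1 = archProj (E := E) (w₀.comap (algebraMap F E)) w₀ x
    rw [archUnitsRepIsoCoind]
    erw [CoinducedModule.coe_corecognitionIso_hom_apply]
    rw [map_one]
    rfl

end Shapiro

/-! ## §4. Shapiro under restriction at an infinite place -/

section TowerShapiro

variable {F K E : Type} [Field F] [Field K] [Field E] [NumberField F] [NumberField K] [NumberField E]
  [Algebra F K] [Algebra K E] [Algebra F E] [IsScalarTower F K E]

omit [NumberField F] [NumberField K] [NumberField E] in
/-- An element of `Gal(E/K)` fixing the infinite place `w₀` fixes it as an element of `Gal(E/F)`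
(`(σ|_F) • w₀ = σ • w₀`). [cite: CasselsFrohlichANT1967, Ch. VII §1.1] -/
theorem restrictScalarsHom_mem_stabilizer {w₀ : InfinitePlace E} (h : MulAction.stabilizer (E ≃ₐ[K] E) w₀) :
    AlgEquiv.restrictScalarsHom F (h : E ≃ₐ[K] E) ∈ MulAction.stabilizer (E ≃ₐ[F] E) w₀ :=
  MulAction.mem_stabilizer_iff.mp h.2

/-- **`Stab_{Gal(E/K)}(w₀) →* Stab_{Gal(E/F)}(w₀)`**, `h ↦ h|_F` (injective). [cite: CasselsFrohlichANT1967, Ch. VII §1.1] -/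
def stabilizerTowerHom (w₀ : InfinitePlace E) :
    MulAction.stabilizer (E ≃ₐ[K] E) w₀ →* MulAction.stabilizer (E ≃ₐ[F] E) w₀ :=
  ((AlgEquiv.restrictScalarsHom F : (E ≃ₐ[K] E) →* (E ≃ₐ[F] E)).comp
    (MulAction.stabilizer (E ≃ₐ[K] E) w₀).subtype).codRestrict _ fun h => restrictScalarsHom_mem_stabilizer (F := F) h

omit [NumberField F] [NumberField K] [NumberField E] in
/-- Unfolding `stabilizerTowerHom`. [cite: CasselsFrohlichANT1967, Ch. VII §1.1] -/
@[simp] theorem coe_stabilizerTowerHom_apply (w₀ : InfinitePlace E) (h : MulAction.stabilizer (E ≃ₐ[K] E) w₀) :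
    ((stabilizerTowerHom (F := F) w₀ h : MulAction.stabilizer (E ≃ₐ[F] E) w₀) : E ≃ₐ[F] E) =
      AlgEquiv.restrictScalarsHom F (h : E ≃ₐ[K] E) := rfl

omit [NumberField F] [NumberField K] [NumberField E] in
/-- `stabilizerTowerHom` is injective. [cite: CasselsFrohlichANT1967, Ch. VII §1.1] -/
theorem stabilizerTowerHom_injective (w₀ : InfinitePlace E) : Function.Injective (stabilizerTowerHom (F := F) (K := K) w₀) := by
  intro a b hab
  have h := congrArg (fun s : MulAction.stabilizer (E ≃ₐ[F] E) w₀ => (s : E ≃ₐ[F] E)) hab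
  simp only [coe_stabilizerTowerHom_apply] at h
  exact Subtype.ext (AlgEquiv.restrictScalars_injective F h)

/-- **The identity `E_{w₀}ˣ → E_{w₀}ˣ` as a morphism `Res_{Stab_H(w₀) → Stab_G(w₀)} E_{w₀}ˣ ⟶ E_{w₀}ˣ`** of
`Stab_{Gal(E/K)}(w₀)`-modules (the transport `h_{w₀}` of `h ∈ Gal(E/K)` is that of `h|_F`).
[cite: CasselsFrohlichANT1967, Ch. VII §1.1] -/
def archLocalResHom (w₀ : InfinitePlace E) :
    Rep.res (stabilizerTowerHom (F := F) (K := K) w₀) (archLocalUnitsRep (F := F) w₀) ⟶ archLocalUnitsRep (F := K) w₀ :=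
  Rep.ofHom ⟨LinearMap.id, fun _ => LinearMap.ext fun _ => rfl⟩

/-- **Local restriction `Res : Hⁿ(Stab_{Gal(E/F)}(w₀), E_{w₀}ˣ) ⟶ Hⁿ(Stab_{Gal(E/K)}(w₀), E_{w₀}ˣ)`** at an infinite place.
[cite: CasselsFrohlichANT1967, Ch. VII §9.7 (15)] -/
def archLocalRes (w₀ : InfinitePlace E) (n : ℕ) :
    groupCohomology (archLocalUnitsRep (F := F) w₀) n ⟶ groupCohomology (archLocalUnitsRep (F := K) w₀) n :=
  groupCohomology.map (stabilizerTowerHom (F := F) (K := K) w₀) (archLocalResHom (F := F) (K := K) w₀) n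

/-- **Shapiro under restriction at an infinite place** (Tate VII §9.7: the reduction of (15) to the local case): for
`y ∈ Hⁿ(Gal(E/F), ∏_{w∣v} E_wˣ)` (`v = w₀|_F`), restricting to `Gal(E/K)`, cutting off to the block at `v' = w₀|_K` and
applying the Shapiro isomorphism of `E/K` at `w₀` gives the LOCAL restriction along `Stab_H(w₀) ↪ Stab_G(w₀)` of the Shapiro
image of `y` for `E/F`.  Both sides are `Hⁿ` of one morphism of pairs `(Stab_H(w₀), E_{w₀}ˣ) → (Gal(E/F), ∏_{w∣v} E_wˣ)`.
[cite: CasselsFrohlichANT1967, Ch. VII §9.7 (15)] -/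
theorem groupCohomologyArchUnitsRepIso_hom_map_archTowerBlock [IsGalois F E] (w₀ : InfinitePlace E) (n : ℕ)
    (y : groupCohomology (archUnitsRep (E := E) (w₀.comap (algebraMap F E))) n) :
    haveI : IsGalois K E := IsGalois.tower_top_of_isGalois F K E
    (groupCohomologyArchUnitsRepIso (F := K) w₀ n).hom
        (groupCohomology.map (AlgEquiv.restrictScalarsHom F)
          (archTowerBlock E (w₀.comap (algebraMap F E)) (w₀.comap (algebraMap K E))) n y) =
      archLocalRes (F := F) (K := K) w₀ n ((groupCohomologyArchUnitsRepIso (F := F) w₀ n).hom y) := by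
  haveI : IsGalois K E := IsGalois.tower_top_of_isGalois F K E
  have key : groupCohomology.map (AlgEquiv.restrictScalarsHom F)
        (archTowerBlock E (w₀.comap (algebraMap F E)) (w₀.comap (algebraMap K E))) n ≫
      (groupCohomologyArchUnitsRepIso (F := K) w₀ n).hom =
    (groupCohomologyArchUnitsRepIso (F := F) w₀ n).hom ≫ archLocalRes (F := F) (K := K) w₀ n := by
    rw [groupCohomologyArchUnitsRepIso_hom_eq, groupCohomologyArchUnitsRepIso_hom_eq, archLocalRes,
      ← groupCohomology.map_comp, ← groupCohomology.map_comp]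
    refine map_congr' ?_ _ _ (fun a => ?_) n
    · ext h; rfl
    · change archProj (E := E) (w₀.comap (algebraMap K E)) w₀
          ((archTowerBlock E (w₀.comap (algebraMap F E)) (w₀.comap (algebraMap K E))).hom a) =
        archProj (E := E) (w₀.comap (algebraMap F E)) w₀ a
      exact archProj_archTowerBlock _ _ rfl a
  exact congrArg (fun φ => φ.hom y) key

omit [NumberField K] in
/-- **When the two decomposition groups have the same order, the local restriction is injective** (then
`Stab_H(w₀) ↪ Stab_G(w₀)` is an isomorphism and `Res` is the transport `groupCohomology.mapIso`).
[cite: CasselsFrohlichANT1967, Ch. VII §9.7 (15)] -/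
theorem archLocalRes_injective_of_natCard_eq (w₀ : InfinitePlace E) (n : ℕ)
    (h : Nat.card (MulAction.stabilizer (E ≃ₐ[K] E) w₀) = Nat.card (MulAction.stabilizer (E ≃ₐ[F] E) w₀)) :
    Function.Injective (archLocalRes (F := F) (K := K) w₀ n) := by
  have hbij : Function.Bijective (stabilizerTowerHom (F := F) (K := K) w₀) :=
    (Nat.bijective_iff_injective_and_card _).mpr ⟨stabilizerTowerHom_injective w₀, h⟩
  let e : MulAction.stabilizer (E ≃ₐ[K] E) w₀ ≃* MulAction.stabilizer (E ≃ₐ[F] E) w₀ := MulEquiv.ofBijective _ hbij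
  let iso : groupCohomology (archLocalUnitsRep (F := K) w₀) n ≅ groupCohomology (archLocalUnitsRep (F := F) w₀) n :=
    groupCohomology.mapIso e (LinearEquiv.refl ℤ _) (fun _ => rfl) n
  have hiso : archLocalRes (F := F) (K := K) w₀ n = iso.inv := by
    rw [archLocalRes, groupCohomology.mapIso_inv]
    exact map_congr' rfl _ _ (fun _ => rfl) n
  rw [hiso]
  exact iso.symm.toLinearEquiv.injective

end TowerShapiro

end ArchHerbrand

/-! ## §5. `inv_{v'}(Res c) = (n_v / n_{v'}) · inv_v(c)` at the infinite places -/

namespace IdeleCohomology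

open Literature.Algebra.Homology ArchHerbrand

section Tower

variable {F K E : Type} [Field F] [Field K] [Field E] [NumberField F] [NumberField K] [NumberField E]
  [Algebra F K] [Algebra K E] [Algebra F E] [IsScalarTower F K E]

omit [NumberField K] in
/-- `Stab_{Gal(E/K)}(w₀)` has order at most that of `Stab_{Gal(E/F)}(w₀)` (it embeds).
[cite: CasselsFrohlichANT1967, Ch. VII §1.1] -/
theorem natCard_stabilizer_tower_le (w₀ : InfinitePlace E) :
    Nat.card (MulAction.stabilizer (E ≃ₐ[K] E) w₀) ≤ Nat.card (MulAction.stabilizer (E ≃ₐ[F] E) w₀) :=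
  Nat.card_le_card_of_injective _ (stabilizerTowerHom_injective (F := F) (K := K) w₀)

/-- **Tate VII §9.7 (15) at an infinite place**: for `E/F` Galois, `F ⊆ K ⊆ E`, `c ∈ H²(Gal(E/F), J_E)` and an infinite
place `w₀` of `E`, `inv_{w₀|_K}(Res_{Gal(E/K)} c) = (n_v / n_{v'}) · inv_{w₀|_F}(c)` with `n_v = #Stab_{Gal(E/F)}(w₀)`,
`n_{v'} = #Stab_{Gal(E/K)}(w₀)` (so `n_v / n_{v'} = [K_{v'} : F_v] ∈ {1, 2}`).  Proof: if `n_{v'} = 1` both sides vanish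
(`H²` of the trivial group; `n_v · inv_v(c) = 0`); if `n_{v'} = 2 = n_v` the local restriction is an isomorphism and two
injective homomorphisms from a group of order `2` into `ℚ/ℤ` agree. [cite: CasselsFrohlichANT1967, Ch. VII §9.7 (15)] -/
theorem localInvInfAt_ideleRes [IsGalois F E] (w₀ : InfinitePlace E) (c : groupCohomology (IdeleClassGroup.ideleRep F E) 2) :
    haveI : IsGalois K E := IsGalois.tower_top_of_isGalois F K E
    localInvInfAt (F := K) w₀ (ideleRes F K E 2 c) =
      (Nat.card (MulAction.stabilizer (E ≃ₐ[F] E) w₀) / Nat.card (MulAction.stabilizer (E ≃ₐ[K] E) w₀)) •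
        localInvInfAt (F := F) w₀ c := by
  haveI : IsGalois K E := IsGalois.tower_top_of_isGalois F K E
  set v := w₀.comap (algebraMap F E) with hv
  set v' := w₀.comap (algebraMap K E) with hv'
  have hvv' : IsOver K v v' := by
    rw [IsOver, hv', hv, InfinitePlace.comap_comap_tower F K E]
  -- the `v`-component of `c` and the two readings
  set y := groupCohomology.map (MonoidHom.id (E ≃ₐ[F] E)) (infPlaceProj (E := E) v) 2 c with hy
  have hL : localInvInfAt (F := K) w₀ (ideleRes F K E 2 c) =
      archLayerInv (F := K) w₀ (archLocalRes (F := F) (K := K) w₀ 2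
        ((groupCohomologyArchUnitsRepIso (F := F) w₀ 2).hom y)) := by
    rw [localInvInfAt_eq_archInvAt, map_infPlaceProj_ideleRes hvv', ← hy, archInvAt, AddMonoidHom.coe_comp,
      Function.comp_apply]
    exact congrArg (archLayerInv (F := K) w₀) (groupCohomologyArchUnitsRepIso_hom_map_archTowerBlock w₀ 2 y)
  have hR : localInvInfAt (F := F) w₀ c = archLayerInv (F := F) w₀ ((groupCohomologyArchUnitsRepIso (F := F) w₀ 2).hom y) := by
    rw [localInvInfAt_eq_archInvAt, ← hy, archInvAt, AddMonoidHom.coe_comp, Function.comp_apply]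
    rfl
  rcases InfinitePlace.nat_card_stabilizer_eq_one_or_two K w₀ with h1 | h2
  · -- `Stab_H(w₀)` trivial: the target `H²` vanishes, and `n_v • inv_v(c) = 0`
    haveI : Subsingleton (MulAction.stabilizer (E ≃ₐ[K] E) w₀) := (Nat.card_eq_one_iff_unique.mp h1).1
    haveI : Subsingleton (groupCohomology (archLocalUnitsRep (F := K) w₀) 2) :=
      ModuleCat.subsingleton_of_isZero (isZero_groupCohomology_succ_of_subsingleton _ 1)
    rw [hL, Subsingleton.elim (archLocalRes (F := F) (K := K) w₀ 2 _) 0, map_zero, h1, Nat.div_one,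
      natCard_stabilizer_nsmul_localInvInfAt]
  · -- `#Stab_H(w₀) = 2 = #Stab_G(w₀)`: `Res` is an isomorphism; uniqueness of injective maps of a group of order 2
    have hG : Nat.card (MulAction.stabilizer (E ≃ₐ[F] E) w₀) = 2 := by
      have hle := natCard_stabilizer_tower_le (F := F) (K := K) w₀
      rw [h2] at hle
      rcases InfinitePlace.nat_card_stabilizer_eq_one_or_two F w₀ with h | h
      · rw [h] at hle; exact absurd hle (by decide)
      · exact h
    have hA : Nat.card (groupCohomology (archLocalUnitsRep (F := F) w₀) 2) = 1 ∨
        Nat.card (groupCohomology (archLocalUnitsRep (F := F) w₀) 2) = 2 :=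
      natCard_H2_archLocalUnitsRep_eq_one_or_two (F := F) w₀
    have hinj : Function.Injective ((archLayerInv (F := K) w₀).comp
        (archLocalRes (F := F) (K := K) w₀ 2).hom.toAddMonoidHom) :=
      (archLayerInv_injective (F := K) w₀).comp (archLocalRes_injective_of_natCard_eq w₀ 2 (h2.trans hG.symm))
    have key := addMonoidHom_eq_of_injective_of_natCard hA hinj (archLayerInv_injective (F := F) w₀)
    rw [hL, hR, h2, hG, Nat.div_self (by decide), one_smul]
    exact DFunLike.congr_fun key _

/-- **`localInvInf E v' (Res c) = (n_v / n_{v'}) · localInvInf E v c`** for an infinite place `v'` of `K` above `v`, with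
`n_v`, `n_{v'}` the orders of the decomposition groups at any place `w₀` of `E` above `v'` (the canonical `localInvInf` is
`localInvInfAt` at any place above, `localInvInf_eq_localInvInfAt`). [cite: CasselsFrohlichANT1967, Ch. VII §9.7 (15)] -/
theorem localInvInf_ideleRes [IsGalois F E] {v : InfinitePlace F} {v' : InfinitePlace K} {w₀ : InfinitePlace E}
    (hv' : IsOver K v v') (hw₀ : IsOver E v' w₀) (c : groupCohomology (IdeleClassGroup.ideleRep F E) 2) :
    haveI : IsGalois K E := IsGalois.tower_top_of_isGalois F K E
    localInvInf E v' (ideleRes F K E 2 c) =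
      (Nat.card (MulAction.stabilizer (E ≃ₐ[F] E) w₀) / Nat.card (MulAction.stabilizer (E ≃ₐ[K] E) w₀)) •
        localInvInf E v c := by
  haveI : IsGalois K E := IsGalois.tower_top_of_isGalois F K E
  rw [localInvInf_eq_localInvInfAt hw₀, localInvInf_eq_localInvInfAt (isOver_of_isOver_tower hv' hw₀),
    localInvInfAt_ideleRes]

end Tower

end IdeleCohomology

end Literature.NumberTheory.GaloisRepresentations

end
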